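import Literature.MathematicalPhysics.QuantumFieldTheory.Balaban1983to89.B11SeminormSize190
import Literature.MathematicalPhysics.QuantumFieldTheory.Balaban1983to89.B14Ineq38From190
import Literature.MathematicalPhysics.QuantumFieldTheory.Balaban1983to89.B14Eq322From190
import Literature.MathematicalPhysics.QuantumFieldTheory.Balaban1983to89.B14Eq119From190

/-!
# `Balaban1983to89.B14From190SupSize` — T. Bałaban, *Convergent renormalization expansions for lattice gauge theories*,
# Commun. Math. Phys. **119** (1988) 243–285 [Balaban1988Convergent] = [III]: the four (190)-knittings of §§1, 3 (pp. 250,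
# 266, 268, 269) with the block-size ↔ lattice-value DICTIONARY hypothesis `hdom` DISCHARGED for the FUNCTION size, by
# instantiating [15]'s output size at the sup size `B11SupSize190.supSize` ((190) p. 308 *"for x ∈ Δ(y)"*)

statement-level skeleton of published theorems with citation tags; proofs where landed; nothing here is a claim
about the Yang–Mills mass gap

CITATION HEADER (lean-in-tree rule 2026-08-18).  T. Bałaban, *Convergent renormalization expansions for lattice gauge
theories*, Commun. Math. Phys. **119**, 243–285 (1988), doi:10.1007/BF01217741, bib `Balaban1988Convergent` (cell paper
B14 = "[III]"; PDF held `paper:balaban1988-cmp119-convergent-renormalization`, pp. 250, 266, 268, 269 = PDF 8, 24, 26, 27).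
"[15]" = [Balaban1985Variational] (190) p. 308 (`B11SectG.Ineq190`, and the sup size `B11SupSize190.supSize`).

WHAT IS REPRODUCED.  SKELETON rows **B14.Claim@265** ((3.7)/(3.8)), **B14.Eq3.16–3.19** ((3.18)/(3.19)), **B14.Eq3.21–3.22**
(the p. 269 bound on `𝐇^{(k)}`), **B14.Eq1.18–1.19** (the p. 250 bound) — the same printed sentences as in r11's
`B14Ineq38From190`, `B14Ineq319From190`, `B14Eq322From190`, `B14Eq119From190` (quoted there verbatim), now with [15]'s output
size of (190) READ CONCRETELY as *"sup_{x∈Δ(y)}|·|"*: `bout := supSize g box blk` on p29's `ℤ^d` bond fields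
`B7Prop1Explicit.Site d → Fin d → 𝔸` (`box y` = the finite set of sites the consumer reads — the four bond base points of `∂p`,
resp. the sites of `B^k(b₋) ∪ B^k(b₊)`; `blk` any block map).  Mega-formalization `lit-balaban`, HOME
`run/shared/lean/pub/lit-balaban/`, unit `lit-balaban-r11` gen 7 (B14 fold owner).  KNITTING — used BY NAME, nothing restated:
r11's four `…_of_ineq190` theorems and `B11SupSize190.norm_apply_apply_le_loc` (the dictionary lemma).

WHAT THIS FILE PROVES (kernel-checked, zero `sorry`; no `def`, no new `Prop`, no new named fact; axioms standard).
* `ineq319_lt_lattice_of_ineq190_sup` — (3.19) `< δ_k` on the lattice model from (190) FOR THE SUP SIZE, the dictionary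
  hypothesis `hdom` of `B14Ineq319From190.ineq319_lt_lattice_of_ineq190` REPLACED by the membership `hbox : InBox … y′ → y′ ∈ box y`
  (i.e. the box of the block `y` contains the sites of `B^k(b₋) ∪ B^k(b₊)` — set geometry, no analysis).
* `norm_bH322_le_lattice_of_ineq190_sup` — the p. 269 bound on `𝐇^{(k)}` likewise (`B14Eq322From190`).
* `dev119_le_lattice_of_ineq190_sup` — the p. 250 bound `|U₁U_{1,□′}⁻¹ − 1| < O(1)B₃e^{−δLM₂R₁}ε₁` likewise (`B14Eq119From190`).
* `ineq38_lt_lattice_of_ineq190_sup` — (3.8) `|U_{k,□}(∂p) − 1| < ε_kη²` with the FUNCTION-size dictionary `hdom₁…₄` of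
  `B14Ineq38From190.ineq38_lt_lattice_of_ineq190` REPLACED by the membership of the three base points `x, x + e_μ, x + e_ν` of the
  bonds of `∂p` in `box y`; the covariant-derivative size `bout₁` and its two dictionary hypotheses `hdomD₁,₂` stay abstract
  (cell GAPS.md G-B15-r12-08 addendum: the derivative size is not a naive sup size).
HONEST SCOPE.  Exactly that of the four knitting files, minus the function-size dictionary: (190) itself — now the concrete
`∀ t, Ineq190 bB (supSize g box blk) (dH t) C δ₀`, i.e. [15] Prop. 9 read with the sup output size —, (2.61), the B-size bounds
and localisation distances of the argument fields, the mean-value domination `hmv`, (2.8)/(2.9) where used, p29's lattice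
models and located side conditions remain HYPOTHESES in the printed shapes.  NOT summit progress.
VERSIONS.  v1 = p266115 (commit 35d1cb306d3e; §§1–2).  v1.1 (this file) is APPEND-ONLY: the import `B11SupSize190` is replaced
by its extension `B11SeminormSize190` (same cone plus the derivative size), and the new §3 `ineq38_lt_lattice_of_ineq190_sizes`
discharges ALSO the covariant-derivative dictionary `hdomD₁,₂` of (3.8) by instantiating `bout₁` at
`B11SeminormSize190.covDerivBlockSize gB y₀ S η U₀` (the first-order output size of (190) with print's `∇^η_{U_{k+1,□′}}`): for
(3.7)/(3.8) NO dictionary hypothesis is left either.  No v1 declaration, statement or proof is changed.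
-/

open NormedSpace Finset

namespace Literature.MathematicalPhysics.QuantumFieldTheory.Balaban1983to89.B14From190SupSize

open Literature.MathematicalPhysics.QuantumFieldTheory.Balaban1983to89
open B7Prop1Explicit B7Prop2Explicit B7Prop3Flat B7Eq92Concrete B7Eq162General
open B11SectG B11SupSize190 B11SeminormSize190 B14Ineq38From190 B14Ineq319From190 B14Eq322From190 B14Eq119From190

variable {g : B6.Geometry} {FB : Type} [AddCommGroup FB] [Module ℝ FB]
variable {d : ℕ}

/-! ## §1 (3.19), the p. 269 bound and the p. 250 bound for the sup size -/

section NormedAlgebra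

variable {𝔸 : Type} [NormedRing 𝔸] [NormedAlgebra ℂ 𝔸] [CompleteSpace 𝔸] [NormOneClass 𝔸]

/-- **(3.19) `< δ_k`, ON THE LATTICE MODEL, FROM [15] (190) WITH THE SUP OUTPUT SIZE** — `B14Ineq319From190.ineq319_lt_lattice_of_ineq190`
at `bout := supSize g box blk`, its dictionary hypothesis `hdom` discharged by `B11SupSize190.norm_apply_apply_le_loc` from the
membership `hbox` of the sites of `B^k(b₋) ∪ B^k(b₊)` in the box of the block `y`.
[cite: Balaban1988Convergent, (3.19) p.268; Balaban1985Variational, (190) p.308] -/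
theorem ineq319_lt_lattice_of_ineq190_sup
    (box : g.Site → Finset (B7Prop1Explicit.Site d)) (blk : B7Prop1Explicit.Site d → g.Site)
    {T : Type*} {bB : BlockNorm g FB} {dH : T → FB →ₗ[ℝ] (B7Prop1Explicit.Site d → Fin d → 𝔸)} {C δ₀ σ τ c D : ℝ}
    (h190 : ∀ t, Ineq190 bB (supSize (X := B7Prop1Explicit.Site d) (E := Fin d → 𝔸) g box blk) (dH t) C δ₀)
    (hC : 0 ≤ C) (hd : ∀ a b : g.Site, 0 ≤ g.dist a b)
    (hrow : RowSum g σ c) (hτ : 0 ≤ τ) (hστ : σ + τ ≤ δ₀ / 8) (B : FB) (y : g.Site)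
    {B₃ δ M₂ R1 R β₀ A₀ A₁ ε εk1 δk : ℝ}
    (hm : ∀ y', bB.loc y' B ≤ 44 * (d : ℝ) ^ 2 * B₃ * εk1) (hD : ∀ y', bB.loc y' B ≠ 0 → D ≤ g.dist y y')
    {Hf : B7Prop1Explicit.Site d → Fin d → 𝔸}
    (hmv : ∀ s : ℝ, (∀ t, (supSize (X := B7Prop1Explicit.Site d) (E := Fin d → 𝔸) g box blk).loc y (dH t B) ≤ s) →
      (supSize (X := B7Prop1Explicit.Site d) (E := Fin d → 𝔸) g box blk).loc y Hf ≤ s)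
    {L : ℕ} (hL : 2 ≤ L) {G : Subgroup 𝔸ˣ} (hG : AvgClosed d L G) {k : ℕ}
    {U₀ : B7Prop1Explicit.Site d → Fin d → 𝔸ˣ} (hU₀ : ∀ x κ, U₀ x κ ∈ G) {α₀ : ℝ} (hα : 0 < α₀)
    (hα3 : C0 d * α₀ ≤ 1 / 3) (hα4 : 4 * α₀ ≤ c2' d L) (h52 : pdev U₀ < α₀ * (((L : ℝ) ^ k)⁻¹) ^ 2)
    (q : B7Prop1Explicit.Site d) (κ : Fin d)
    (hgeom : δ * L * M₂ * R1 ≤ τ * D) (hCB : C * bB.κ * c ≤ B₃) (hB₃ : 0 ≤ B₃)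
    (hε1 : 0 ≤ εk1) (hflow : εk1 ≤ (1 + β₀) * ε) (hRR : R ≤ δ * L * M₂ * R1)
    -- the dictionary, now set geometry: the block's box contains the sites the consumer reads
    (hbox : ∀ y', B7Prop1Local.InBox (B7Prop1Local.loK L k q) (B7Prop1Local.bondHiK L k q κ) y' → y' ∈ box y)
    (hβ₀ : 0 ≤ 1 + β₀) (hε : 0 ≤ ε) (hδk : 0 < δk) (hεδ : ε = A₀ / A₁ * δk)
    (hsmall : Real.exp (4 * (800 * ((d : ℝ) + 1) ^ 2 * ((d : ℝ) + 4)) * α₀)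
      * (1 + 8 * (131072 * ((d : ℝ) + 1) ^ 2) * (44 * (d : ℝ) ^ 2 * B₃ ^ 2 * (1 + β₀) * Real.exp (-R) * ε)) ≤ 2)
    (hc₃ : 2 * (44 * (d : ℝ) ^ 2 * B₃ ^ 2 * (1 + β₀) * Real.exp (-R) * ε) ≤ c3 d L)
    (hsm : 2048 * (d : ℝ) * (44 * (d : ℝ) ^ 2 * B₃ ^ 2 * (1 + β₀) * Real.exp (-R) * ε) ≤ 1)
    (h1 : 128 * (44 * (d : ℝ) ^ 2 * B₃ ^ 2 * (1 + β₀) * Real.exp (-R) * ε) ≤ 1)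
    (hgk : (68 * ((d : ℝ) + 1) + 160 * d) * 44 * (d : ℝ) ^ 2 * B₃ ^ 2 * (1 + β₀) * (A₀ / A₁) * Real.exp (-R) < 1)
    (hL1 : 1 ≤ L) :
    ‖((avgIter L
          (gaugeAct (B7Eq84Concrete.glev L hL1 U₀
              (expCfg (fun z μ => ((Complex.I : ℂ) * ((((L : ℝ) ^ (k + 1))⁻¹ : ℝ) : ℂ)) • Hf z μ)) k 0)⁻¹
            (expCfg (fun z μ => ((Complex.I : ℂ) * ((((L : ℝ) ^ (k + 1))⁻¹ : ℝ) : ℂ)) • Hf z μ) * U₀)) k q κ : 𝔸ˣ) : 𝔸)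
        * (((avgIter L U₀ k q κ)⁻¹ : 𝔸ˣ) : 𝔸) - 1‖ < δk :=
  ineq319_lt_lattice_of_ineq190 h190 hC hd hrow hτ hστ B y hm hD hmv hL hG hU₀ hα hα3 hα4 h52 q κ hgeom hCB hB₃ hε1 hflow hRR
    (fun y' μ hy => norm_apply_apply_le_loc (hbox y' hy) Hf μ) hβ₀ hε hδk hεδ hsmall hc₃ hsm h1 hgk hL1

/-- **p. 269, the bound on `𝐇^{(k)}`, ON THE LATTICE MODEL, FROM [15] (190) WITH THE SUP OUTPUT SIZE** —
`B14Eq322From190.norm_bH322_le_lattice_of_ineq190` at `bout := supSize g box blk`, `hdom` discharged from `hbox`.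
[cite: Balaban1988Convergent, (3.22) p.269; Balaban1985Variational, (190) p.308] -/
theorem norm_bH322_le_lattice_of_ineq190_sup
    (box : g.Site → Finset (B7Prop1Explicit.Site d)) (blk : B7Prop1Explicit.Site d → g.Site)
    {T : Type*} {bB : BlockNorm g FB} {dH : T → FB →ₗ[ℝ] (B7Prop1Explicit.Site d → Fin d → 𝔸)} {C δ₀ σ τ c D : ℝ}
    (h190 : ∀ t, Ineq190 bB (supSize (X := B7Prop1Explicit.Site d) (E := Fin d → 𝔸) g box blk) (dH t) C δ₀)
    (hC : 0 ≤ C) (hd : ∀ a b : g.Site, 0 ≤ g.dist a b)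
    (hrow : RowSum g σ c) (hτ : 0 ≤ τ) (hστ : σ + τ ≤ δ₀ / 8) (B : FB) (y : g.Site)
    {B₃ δ M₂ R1 R β₀ ε εk1 : ℝ}
    (hm : ∀ y', bB.loc y' B ≤ 44 * (d : ℝ) ^ 2 * B₃ * εk1) (hD : ∀ y', bB.loc y' B ≠ 0 → D ≤ g.dist y y')
    {Hf : B7Prop1Explicit.Site d → Fin d → 𝔸}
    (hmv : ∀ s : ℝ, (∀ t, (supSize (X := B7Prop1Explicit.Site d) (E := Fin d → 𝔸) g box blk).loc y (dH t B) ≤ s) →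
      (supSize (X := B7Prop1Explicit.Site d) (E := Fin d → 𝔸) g box blk).loc y Hf ≤ s)
    {L : ℕ} (hL : 2 ≤ L) {G : Subgroup 𝔸ˣ} (hG : AvgClosed d L G) {k : ℕ}
    {U₀ : B7Prop1Explicit.Site d → Fin d → 𝔸ˣ} (hU₀ : ∀ x κ, U₀ x κ ∈ G) {α₀ : ℝ} (hα : 0 < α₀)
    (hα3 : C0 d * α₀ ≤ 1 / 3) (hα4 : 4 * α₀ ≤ c2' d L) (h52 : pdev U₀ < α₀ * (((L : ℝ) ^ k)⁻¹) ^ 2)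
    (q : B7Prop1Explicit.Site d) (κ : Fin d)
    (hgeom : δ * L * M₂ * R1 ≤ τ * D) (hCB : C * bB.κ * c ≤ B₃) (hB₃ : 0 ≤ B₃)
    (hε1 : 0 ≤ εk1) (hflow : εk1 ≤ (1 + β₀) * ε) (hRR : R ≤ δ * L * M₂ * R1)
    (hbox : ∀ y', B7Prop1Local.InBox (B7Prop1Local.loK L k q) (B7Prop1Local.bondHiK L k q κ) y' → y' ∈ box y)
    (hβ₀ : 0 ≤ 1 + β₀) (hε : 0 ≤ ε)
    (hsmall : Real.exp (4 * (800 * ((d : ℝ) + 1) ^ 2 * ((d : ℝ) + 4)) * α₀)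
      * (1 + 8 * (131072 * ((d : ℝ) + 1) ^ 2) * (44 * (d : ℝ) ^ 2 * B₃ ^ 2 * (1 + β₀) * Real.exp (-R) * ε)) ≤ 2)
    (hc₃ : 2 * (44 * (d : ℝ) ^ 2 * B₃ ^ 2 * (1 + β₀) * Real.exp (-R) * ε) ≤ c3 d L)
    (hsm : 2048 * (d : ℝ) * (44 * (d : ℝ) ^ 2 * B₃ ^ 2 * (1 + β₀) * Real.exp (-R) * ε) ≤ 1)
    (h1 : 128 * (44 * (d : ℝ) ^ 2 * B₃ ^ 2 * (1 + β₀) * Real.exp (-R) * ε) ≤ 1) (hL1 : 1 ≤ L)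
    (hs : (68 * ((d : ℝ) + 1) + 160 * d) * 44 * (d : ℝ) ^ 2 * B₃ ^ 2 * (1 + β₀) * ε * Real.exp (-R) ≤ 1 / 2) :
    ‖B14.Eq316.bH (avgIter L
          (gaugeAct (B7Eq84Concrete.glev L hL1 U₀
              (expCfg (fun z μ => ((Complex.I : ℂ) * ((((L : ℝ) ^ (k + 1))⁻¹ : ℝ) : ℂ)) • Hf z μ)) k 0)⁻¹
            (expCfg (fun z μ => ((Complex.I : ℂ) * ((((L : ℝ) ^ (k + 1))⁻¹ : ℝ) : ℂ)) • Hf z μ) * U₀)) k q κ)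
        (avgIter L U₀ k q κ)‖
      ≤ 2 * ((68 * ((d : ℝ) + 1) + 160 * d) * 44 * (d : ℝ) ^ 2 * B₃ ^ 2 * (1 + β₀)) * ε * Real.exp (-R) :=
  norm_bH322_le_lattice_of_ineq190 h190 hC hd hrow hτ hστ B y hm hD hmv hL hG hU₀ hα hα3 hα4 h52 q κ hgeom hCB hB₃ hε1 hflow
    hRR (fun y' μ hy => norm_apply_apply_le_loc (hbox y' hy) Hf μ) hβ₀ hε hsmall hc₃ hsm h1 hL1 hs

/-- **p. 250, the bound `|U₁U_{1,□′}⁻¹ − 1| < O(1)B₃exp(−δLM₂R₁)ε₁`, ON THE LATTICE MODEL, FROM [15] (190) WITH THE SUP OUTPUT SIZE**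
— `B14Eq119From190.dev119_le_lattice_of_ineq190` at `bout := supSize g box blk`, `hdom` discharged from `hbox` (the two sites of
the bond, `k = 0`). [cite: Balaban1988Convergent, (1.19) p.250; Balaban1985Variational, (190) p.308] -/
theorem dev119_le_lattice_of_ineq190_sup
    (box : g.Site → Finset (B7Prop1Explicit.Site d)) (blk : B7Prop1Explicit.Site d → g.Site)
    {T : Type*} {bB : BlockNorm g FB} {dH : T → FB →ₗ[ℝ] (B7Prop1Explicit.Site d → Fin d → 𝔸)} {C δ₀ σ τ c D : ℝ}
    (h190 : ∀ t, Ineq190 bB (supSize (X := B7Prop1Explicit.Site d) (E := Fin d → 𝔸) g box blk) (dH t) C δ₀)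
    (hC : 0 ≤ C) (hd : ∀ a b : g.Site, 0 ≤ g.dist a b)
    (hrow : RowSum g σ c) (hτ : 0 ≤ τ) (hστ : σ + τ ≤ δ₀ / 8) (B : FB) (y : g.Site)
    {B₃ δ M₂ R₁ ε₁ : ℝ}
    (hm : ∀ y', bB.loc y' B ≤ 44 * (d : ℝ) ^ 2 * B₃ * ε₁) (hD : ∀ y', bB.loc y' B ≠ 0 → D ≤ g.dist y y')
    {Hf : B7Prop1Explicit.Site d → Fin d → 𝔸}
    (hmv : ∀ s : ℝ, (∀ t, (supSize (X := B7Prop1Explicit.Site d) (E := Fin d → 𝔸) g box blk).loc y (dH t B) ≤ s) →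
      (supSize (X := B7Prop1Explicit.Site d) (E := Fin d → 𝔸) g box blk).loc y Hf ≤ s)
    {L : ℕ} (hL : 2 ≤ L) {G : Subgroup 𝔸ˣ} (hG : AvgClosed d L G)
    {U₀ : B7Prop1Explicit.Site d → Fin d → 𝔸ˣ} (hU₀ : ∀ x κ, U₀ x κ ∈ G) {α₀ : ℝ} (hα : 0 < α₀)
    (hα3 : C0 d * α₀ ≤ 1 / 3) (hα4 : 4 * α₀ ≤ c2' d L) (h52 : pdev U₀ < α₀ * (((L : ℝ) ^ 0)⁻¹) ^ 2)
    (q : B7Prop1Explicit.Site d) (κ : Fin d)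
    (hgeom : δ * L * M₂ * R₁ ≤ τ * D) (hCB : C * bB.κ * c ≤ B₃) (hB₃ : 0 ≤ B₃)
    (hbox : ∀ y', B7Prop1Local.InBox (B7Prop1Local.loK L 0 q) (B7Prop1Local.bondHiK L 0 q κ) y' → y' ∈ box y)
    (hsmall : Real.exp (4 * (800 * ((d : ℝ) + 1) ^ 2 * ((d : ℝ) + 4)) * α₀)
      * (1 + 8 * (131072 * ((d : ℝ) + 1) ^ 2) * (B₃ * Real.exp (-(δ * L * M₂ * R₁)) * (44 * (d : ℝ) ^ 2 * B₃) * ε₁)) ≤ 2)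
    (hc₃ : 2 * (B₃ * Real.exp (-(δ * L * M₂ * R₁)) * (44 * (d : ℝ) ^ 2 * B₃) * ε₁) ≤ c3 d L)
    (hsm : 2048 * (d : ℝ) * (B₃ * Real.exp (-(δ * L * M₂ * R₁)) * (44 * (d : ℝ) ^ 2 * B₃) * ε₁) ≤ 1)
    (h1 : 128 * (B₃ * Real.exp (-(δ * L * M₂ * R₁)) * (44 * (d : ℝ) ^ 2 * B₃) * ε₁) ≤ 1) (hL1 : 1 ≤ L) :
    ‖((avgIter L
          (gaugeAct (B7Eq84Concrete.glev L hL1 U₀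
              (expCfg (fun z μ => ((Complex.I : ℂ) * ((((L : ℝ) ^ (0 + 1))⁻¹ : ℝ) : ℂ)) • Hf z μ)) 0 0)⁻¹
            (expCfg (fun z μ => ((Complex.I : ℂ) * ((((L : ℝ) ^ (0 + 1))⁻¹ : ℝ) : ℂ)) • Hf z μ) * U₀)) 0 q κ : 𝔸ˣ) : 𝔸)
        * (((avgIter L U₀ 0 q κ)⁻¹ : 𝔸ˣ) : 𝔸) - 1‖
      ≤ (68 * ((d : ℝ) + 1) + 160 * d) * (B₃ * Real.exp (-(δ * L * M₂ * R₁)) * (44 * (d : ℝ) ^ 2 * B₃) * ε₁) :=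
  dev119_le_lattice_of_ineq190 h190 hC hd hrow hτ hστ B y hm hD hmv hL hG hU₀ hα hα3 hα4 h52 q κ hgeom hCB hB₃
    (fun y' μ hy => norm_apply_apply_le_loc (hbox y' hy) Hf μ) hsmall hc₃ hsm h1 hL1

end NormedAlgebra

/-! ## §2 (3.8) for the sup FUNCTION size (the derivative size stays abstract) -/

section CStar

variable {FA : Type} [AddCommGroup FA] [Module ℝ FA]
variable {𝔸 : Type} [CStarAlgebra 𝔸] [Nontrivial 𝔸]

/-- **(3.8) ⇒ "Thus χ_k(□) = 1", ON THE LATTICE MODEL, FROM [15] (190) WITH THE SUP FUNCTION SIZE** —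
`B14Ineq38From190.ineq38_lt_lattice_of_ineq190` with the function size `bout₀ := supSize g box blk` (so `𝐇B := H` itself is the
value) and its four dictionary hypotheses `hdom₁…₄` discharged from the membership of the three base points `x`, `x + e_μ`,
`x + e_ν` of the four bonds of `∂p` in the box of the block `y`; the covariant-derivative size `bout₁` (on an abstract space `FA`
carrying a value `HB₁`) and its dictionary `hdomD₁,₂` stay hypotheses.
[cite: Balaban1988Convergent, (3.8) p.266; Balaban1985Variational, (190) p.308] -/
theorem ineq38_lt_lattice_of_ineq190_sup
    {gB : B6.Geometry} (box : gB.Site → Finset (B7Prop1Explicit.Site d)) (blk : B7Prop1Explicit.Site d → gB.Site)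
    {T : Type*} {bB : BlockNorm gB FB} {bout₁ : BlockNorm gB FA}
    {dH₀ : T → FB →ₗ[ℝ] (B7Prop1Explicit.Site d → Fin d → 𝔸)} {dH₁ : T → FB →ₗ[ℝ] FA}
    {C δ₀ σ τ c D B₃ δ M₂ R δk β₀ A₀ A₁ : ℝ}
    (h190₀ : ∀ t, Ineq190 bB (supSize (X := B7Prop1Explicit.Site d) (E := Fin d → 𝔸) gB box blk) (dH₀ t) C δ₀)
    (h190₁ : ∀ t, Ineq190 bB bout₁ (dH₁ t) C δ₀) (hC : 0 ≤ C)
    (hd : ∀ a b : gB.Site, 0 ≤ gB.dist a b) (hrow : RowSum gB σ c) (hτ : 0 ≤ τ) (hστ : σ + τ ≤ δ₀ / 8)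
    {B₁ B₂ : FB} (y : gB.Site)
    {η : ℝ} (hη : 0 < η) (hη1 : η ≤ 1) {U₀ : B7Prop1Explicit.Site d → Fin d → 𝔸ˣ} (h₀ : ∀ z κ, U₀ z κ ∈ U1 𝔸)
    {H : B7Prop1Explicit.Site d → Fin d → 𝔸} (hH : ∀ z κ, IsSelfAdjoint (H z κ))
    {u : B7Prop1Explicit.Site d → 𝔸ˣ} (hu : ∀ z, u z ∈ U1 𝔸) (μ ν : Fin d) (x : B7Prop1Explicit.Site d)
    {εk εk1 L : ℝ}
    (hm₁ : ∀ y', bB.loc y' B₁ ≤ 4 * δk)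
    (hm₂ : ∀ y', bB.loc y' B₂ ≤ 30 * (d : ℝ) ^ 2 * L ^ 2 * B₃ * (1 + β₀) * εk)
    (hD₂ : ∀ y', bB.loc y' B₂ ≠ 0 → D ≤ gB.dist y y')
    (hmv₀ : ∀ s : ℝ, (∀ t, (supSize (X := B7Prop1Explicit.Site d) (E := Fin d → 𝔸) gB box blk).loc y (dH₀ t (B₁ + B₂)) ≤ s) →
      (supSize (X := B7Prop1Explicit.Site d) (E := Fin d → 𝔸) gB box blk).loc y H ≤ s)
    {HB₁ : FA} (hmv₁ : ∀ s : ℝ, (∀ t, bout₁.loc y (dH₁ t (B₁ + B₂)) ≤ s) → bout₁.loc y HB₁ ≤ s)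
    (hgeom : 2 * δ * M₂ * R ≤ τ * D) (hCB : C * bB.κ * c ≤ B₃) (hB₃ : 0 ≤ B₃)
    (hβ : 0 ≤ 1 + β₀) (hδkε : δk = A₁ / A₀ * εk) (hM : 1 ≤ 2 * δ * M₂) (hR : 0 ≤ R)
    (h10 : 4 * B₃ * A₁ / A₀ + 30 * (d : ℝ) ^ 2 * L ^ 2 * B₃ ^ 2 * (1 + β₀) * Real.exp (-R) < 1/10)
    -- the function-size dictionary, now set geometry
    (hx : x ∈ box y) (hxμ : x + e μ ∈ box y) (hxν : x + e ν ∈ box y)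
    -- the derivative-size dictionary (abstract)
    (hdomD₁ : ‖B8Ineq132.covDerivFwd η U₀ μ (fun z => H z ν) x‖ ≤ bout₁.loc y HB₁)
    (hdomD₂ : ‖B8Ineq132.covDerivFwd η U₀ ν (fun z => H z μ) x‖ ≤ bout₁.loc y HB₁)
    (hε : 0 < εk) (hε1 : εk ≤ 1) (hL : 0 < L) (hε' : 0 < εk1) (hflow : εk1 ≤ (1 + β₀) * εk)
    (hrestr : 2 * (1 + β₀) * L⁻¹ ^ 2 + 4/10 < 1)
    (hdev₀ : ‖B8Ineq132.plaqF U₀ μ ν x - 1‖ < εk1 * (L⁻¹ * η) ^ 2) :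
    ‖B8Ineq132.plaqF (gaugeAct u (B8Lemma1NonAbelian.mulCfg (B8Eq146AExpansion.expCfg
        (B8Eq146AExpansion.iEta η H)) U₀)) μ ν x - 1‖ < εk * η ^ 2 := by
  -- function size: the six-hypothesis theorem with `bout₀ := supSize`, `HB := H`; the two sizes live on different value
  -- spaces, so we assemble from `ineq37_lt_of_ineq190` twice and p29's `ineq38_lt` (as in `ineq38_lt_lattice_of_ineq190`).
  have hb₀ := ineq37_lt_of_ineq190 h190₀ hC hd hrow hτ hστ y hm₁ hm₂ hD₂ hmv₀ hgeom hCB hB₃ hε hβ hδkε hM hR h10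
  have hb₁ := ineq37_lt_of_ineq190 h190₁ hC hd hrow hτ hστ y hm₁ hm₂ hD₂ hmv₁ hgeom hCB hB₃ hε hβ hδkε hM hR h10
  have hb₀' : (supSize (X := B7Prop1Explicit.Site d) (E := Fin d → 𝔸) gB box blk).loc y H ≤ εk / 10 := by linarith
  have hb₁' : bout₁.loc y HB₁ ≤ εk / 10 := by linarith
  exact B14Ineq38Proof.ineq38_lt hη hη1 h₀ hH hu μ ν x hε hε1 hL hε' hflow hrestr hdev₀
    ((norm_apply_apply_le_loc hx H μ).trans hb₀') ((norm_apply_apply_le_loc hxμ H ν).trans hb₀')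
    ((norm_apply_apply_le_loc hxν H μ).trans hb₀') ((norm_apply_apply_le_loc hx H ν).trans hb₀')
    (hdomD₁.trans hb₁') (hdomD₂.trans hb₁')

end CStar

/-! ## §3 (v1.1) (3.8) with BOTH dictionaries discharged: the sup function size and the covariant-derivative size -/

section Sizes

variable {𝔸 : Type} [CStarAlgebra 𝔸] [Nontrivial 𝔸]

/-- **(3.8) ⇒ "Thus χ_k(□) = 1", ON THE LATTICE MODEL, FROM [15] (190) WITH BOTH OUTPUT SIZES CONCRETE** —
`B14Ineq38From190.ineq38_lt_lattice_of_ineq190` at `bout₀ := supSize gB box blk` (*"sup_{x∈Δ(y)}|𝐇_{k,□}|"*) and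
`bout₁ := covDerivBlockSize gB y₀ S η U₀` (*"sup_{x∈Δ(y)}|∇^η_{U_{k+1,□′}}𝐇_{k,□}|"*, the covariant derivative at the background
`U₀ = U_{k+1,□′}` exactly as printed in (3.7)), `𝐇B := H` the lattice function itself: the six dictionary hypotheses REPLACED by
the membership of the base points `x, x + e_μ, x + e_ν` in `box y` and of the two derivative points `(x, μ, ν)`, `(x, ν, μ)` in
`S y` (set geometry).  NO dictionary hypothesis left. [cite: Balaban1988Convergent, (3.8) p.266; Balaban1985Variational, (190) p.308] -/
theorem ineq38_lt_lattice_of_ineq190_sizes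
    {gB : B6.Geometry} (box : gB.Site → Finset (B7Prop1Explicit.Site d)) (blk : B7Prop1Explicit.Site d → gB.Site)
    (y₀ : gB.Site) (S : gB.Site → Finset (B7Prop1Explicit.Site d × Fin d × Fin d))
    {T : Type*} {bB : BlockNorm gB FB} {dH : T → FB →ₗ[ℝ] (B7Prop1Explicit.Site d → Fin d → 𝔸)}
    {C δ₀ σ τ c D B₃ δ M₂ R δk β₀ A₀ A₁ : ℝ}
    {η : ℝ} {U₀ : B7Prop1Explicit.Site d → Fin d → 𝔸ˣ}
    (h190₀ : ∀ t, Ineq190 bB (supSize (X := B7Prop1Explicit.Site d) (E := Fin d → 𝔸) gB box blk) (dH t) C δ₀)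
    (h190₁ : ∀ t, Ineq190 bB (covDerivBlockSize gB y₀ S η U₀) (dH t) C δ₀) (hC : 0 ≤ C)
    (hd : ∀ a b : gB.Site, 0 ≤ gB.dist a b) (hrow : RowSum gB σ c) (hτ : 0 ≤ τ) (hστ : σ + τ ≤ δ₀ / 8)
    {B₁ B₂ : FB} (y : gB.Site)
    (hη : 0 < η) (hη1 : η ≤ 1) (h₀ : ∀ z κ, U₀ z κ ∈ U1 𝔸)
    {H : B7Prop1Explicit.Site d → Fin d → 𝔸} (hH : ∀ z κ, IsSelfAdjoint (H z κ))
    {u : B7Prop1Explicit.Site d → 𝔸ˣ} (hu : ∀ z, u z ∈ U1 𝔸) (μ ν : Fin d) (x : B7Prop1Explicit.Site d)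
    {εk εk1 L : ℝ}
    (hm₁ : ∀ y', bB.loc y' B₁ ≤ 4 * δk)
    (hm₂ : ∀ y', bB.loc y' B₂ ≤ 30 * (d : ℝ) ^ 2 * L ^ 2 * B₃ * (1 + β₀) * εk)
    (hD₂ : ∀ y', bB.loc y' B₂ ≠ 0 → D ≤ gB.dist y y')
    (hmv₀ : ∀ s : ℝ, (∀ t, (supSize (X := B7Prop1Explicit.Site d) (E := Fin d → 𝔸) gB box blk).loc y (dH t (B₁ + B₂)) ≤ s) →
      (supSize (X := B7Prop1Explicit.Site d) (E := Fin d → 𝔸) gB box blk).loc y H ≤ s)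
    (hmv₁ : ∀ s : ℝ, (∀ t, (covDerivBlockSize gB y₀ S η U₀).loc y (dH t (B₁ + B₂)) ≤ s) →
      (covDerivBlockSize gB y₀ S η U₀).loc y H ≤ s)
    (hgeom : 2 * δ * M₂ * R ≤ τ * D) (hCB : C * bB.κ * c ≤ B₃) (hB₃ : 0 ≤ B₃)
    (hβ : 0 ≤ 1 + β₀) (hδkε : δk = A₁ / A₀ * εk) (hM : 1 ≤ 2 * δ * M₂) (hR : 0 ≤ R)
    (h10 : 4 * B₃ * A₁ / A₀ + 30 * (d : ℝ) ^ 2 * L ^ 2 * B₃ ^ 2 * (1 + β₀) * Real.exp (-R) < 1/10)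
    -- the dictionaries, now set geometry
    (hx : x ∈ box y) (hxμ : x + e μ ∈ box y) (hxν : x + e ν ∈ box y)
    (hS₁ : (x, μ, ν) ∈ S y) (hS₂ : (x, ν, μ) ∈ S y)
    (hε : 0 < εk) (hε1 : εk ≤ 1) (hL : 0 < L) (hε' : 0 < εk1) (hflow : εk1 ≤ (1 + β₀) * εk)
    (hrestr : 2 * (1 + β₀) * L⁻¹ ^ 2 + 4/10 < 1)
    (hdev₀ : ‖B8Ineq132.plaqF U₀ μ ν x - 1‖ < εk1 * (L⁻¹ * η) ^ 2) :
    ‖B8Ineq132.plaqF (gaugeAct u (B8Lemma1NonAbelian.mulCfg (B8Eq146AExpansion.expCfg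
        (B8Eq146AExpansion.iEta η H)) U₀)) μ ν x - 1‖ < εk * η ^ 2 :=
  ineq38_lt_lattice_of_ineq190 h190₀ h190₁ hC hd hrow hτ hστ y hη hη1 h₀ hH hu μ ν x hm₁ hm₂ hD₂ hmv₀ hmv₁ hgeom hCB hB₃ hβ
    hδkε hM hR h10 (norm_apply_apply_le_loc hx H μ) (norm_apply_apply_le_loc hxμ H ν) (norm_apply_apply_le_loc hxν H μ)
    (norm_apply_apply_le_loc hx H ν) (norm_covDerivFwd_le_loc hS₁ H) (norm_covDerivFwd_le_loc hS₂ H) hε hε1 hL hε' hflow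
    hrestr hdev₀

end Sizes

end Literature.MathematicalPhysics.QuantumFieldTheory.Balaban1983to89.B14From190SupSize
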